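/-
COR-CM (cell pub-hodgecm2, stage 2 of the Hodge ladder) — count-neutral KERNEL COMBINATORICS «the generation binder is insensitive to
saturation; the pre-quotient certificate socket» (seat prover-pub-hodgecm2-b23-g31-0, binder prover b23, gen 31; claim INT2-ORBIT
addendum F3, HOME/lit/LIT-STATUS.md 2026-08-21; sequel of `CorCM/FaceCharacterReads.lean` p279781).  Pure CM-type combinatorics;
theorems only; no geometry, no `Universe`, no definition, no named fact, nothing asserted.  Seat b30's certificate shape
(`Census/FaceSquaresLattice.lean`, `generationCertOK`) is matched BY SHAPE, nothing of theirs is imported or restated;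
`Interfaces.lean` (C1), every E term, B01 and `Transposition/*` are untouched.
HONEST FRAMING (COORDINATOR RULING — HODGE FRAMING CORRECTION, 2026-08-21T11:55:35Z): `HC_CM` is NOT proved, here or anywhere in
the tree; this file proves no face period and no generation statement for any particular field.
-/
import Summits.HodgeConjecture.CorCM.FaceCharacterReads
import HarnessLib

/-!
# The generation binder `hgen` is insensitive to saturation; the pre-quotient certificate socket

`hgen(𝒮, σ₀)` — the one combinatorial binder of the generating-set face reduction (`Universe.hc_cmProd_of_faceSet`,
`CorCM/FacePeriodsGeneratingSet.lean`) — asks that the `σ₀`-Weil characters of all faces of `F` lie in the subgroup of `Asym F`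
generated by the Weil characters, at all base embeddings, of the faces of `𝒮`.  A finite census naturally certifies generation by
the faces of the UNION OF THE ORBITS of `𝒮` (all Galois twists of the members of `𝒮` and all eight faces of each of their type
squares: seat b30's `generationCertOK`, `Census/FaceSquaresLattice.lean`), and it does so BEFORE passing to the quotient by pairs, as
identities of corner indicators `1_{corners f} = Σ_i c_i · 1_{corners g_i} + Σ_j d_j · 1_{{P_j, P̄_j}}`.  This file closes both gaps
on the tree side:

* §1 `weightRel_corner_eq_read` — the corner indicator of a face read in the group `E = GalT F` along `σ`:
  `[Φ′] + [Φ̄′^{(t)}] + [Φ̄′^{(t′)}] + [Φ′^{(tt′)}]` with `Φ′ = pullType f.Φ σ`, `t, t′` the translates carrying `σ` to `π, π′`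
  (the pre-quotient companion of `lefChar_corner_eq_abar_gface`).
* §2 `lefChar_corner_mem_closure_of_sameSquare_twist`, `closure_le_of_saturation`, **`hgen_of_hgen_saturation`** — if every member of
  `𝒮′` shares its type square (seat b07's `hpl`/`hΦ`) with a Galois twist (seat b06's `Face.twist`) of a member of `𝒮`, then the
  characters of `𝒮′` generate no more than those of `𝒮`; hence `hgen(𝒮′) ⟹ hgen(𝒮)`: a certificate over the saturation of `𝒮`
  yields the face reduction with Weil lines / period witnesses on `𝒮` ITSELF.
* §3 **`hgen_of_weightRel_mem_span`** — the PRE-QUOTIENT SOCKET: corner-indicator identities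
  `weightRel f.corner (fun _ => {σ₀}) ∈ span ℤ {weightRel g.corner (fun _ => {σ}) | g ∈ 𝒮, σ} ⊔ pairRel` in `ℤ[types of (E, c)]`
  imply `hgen(𝒮, σ₀)` (`ā` kills `pairRel`, `abar_weightRel`); `hgen_of_weightRel_mem_span_saturation` combines §2 and §3.

References: [QW8] Def. 2.3 / Thm 2.5 and rfwf v3 §8 (the cell's 2001 sources; kernel `CM/LefschetzChar*`, `Prior/AllgGroup*`);
[cite: Milne1999LefschetzClasses, Thm. 3.2]; [cite: Pohlmann1968, Thm. 1].
-/

noncomputable section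

open NumberField NumberField.ComplexEmbedding

namespace Summit.HodgeConjecture.CorCM

open Literature.AlgebraicGeometry.Motives (CMType)
open Literature.NumberTheory.ComplexMultiplication.CMTypeOps
open Literature.NumberTheory.Automorphic.PicardCM.CMCode (cmTypeMap mem_cmTypeMap_iff)
open Summit.HodgeConjecture.CorCM.Prior.AllgGroup.RfwfAllgGroup

variable {F : Type} [Field F] [NumberField F]

/-! ## §1 The corner indicator of a face read in the group -/

/-- **The corner indicator of a face, read in the group (pre-quotient dictionary).**  For a face `f = (Φ; π, π′)` of a Galois CM
field and a base embedding `σ`, the weight relation of the corner weight "eigencharacter `σ` on each corner" is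
`[Φ′] + [Φ̄′^{(t)}] + [Φ̄′^{(t′)}] + [Φ′^{(t′t)}]` in `ℤ[types of (E, c)]`, where `Φ′ = pullType f.Φ σ` and `t = translate σ π`,
`t′ = translate σ π′` — the CORNER SET of the face read along `σ` (seat b30's `corners` in the finite model).  Its image under `ā` is
the Lefschetz character (`abar_weightRel`, `lefChar_corner_eq_abar_gface`). [cite: Milne1999LefschetzClasses, Thm. 3.2] -/
theorem weightRel_corner_eq_read [IsGalois ℚ F] (f : Face F) (σ : F →+* ℂ) :
    weightRel f.corner (fun _ => ({σ} : Finset (F →+* ℂ))) =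
      Finsupp.single (pullType f.Φ σ) 1 +
        Finsupp.single (barCM (oflipCM conjT conjT_mul_self (translate σ f.p) (pullType f.Φ σ))) 1 +
        Finsupp.single (barCM (oflipCM conjT conjT_mul_self (translate σ f.p') (pullType f.Φ σ))) 1 +
        Finsupp.single (oflipCM conjT conjT_mul_self (translate σ f.p')
          (oflipCM conjT conjT_mul_self (translate σ f.p) (pullType f.Φ σ))) 1 := by
  unfold weightRel
  rw [Fin.sum_univ_four]
  simp only [Finset.sum_singleton]
  change Finsupp.single (pullType f.Φ σ) 1 + Finsupp.single (pullType (flip f.p (bar f.Φ)) σ) 1 +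
      Finsupp.single (pullType (flip f.p' (bar f.Φ)) σ) 1 + Finsupp.single (pullType (flip f.p' (flip f.p f.Φ)) σ) 1 = _
  rw [Face.flip_bar, Face.flip_bar]
  simp only [pullType_flip_translate, pullType_bar]

/-! ## §2 `hgen` is insensitive to saturation by type squares and Galois twists -/

/-- **A face sharing its type square with a Galois twist of `g` has all its Weil characters in the subgroup generated by the Weil
characters of `g`** (at all base embeddings): by `lefChar_corner_of_sameSquare` the character is `±` that of `g·τ`, and by
`lefChar_corner_twist` the latter is the character of `g` at the base embedding `σ ∘ τ`. [cite: Milne1999LefschetzClasses, Thm. 3.2] -/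
theorem lefChar_corner_mem_closure_of_sameSquare_twist {f' g : Face F} {τ : F ≃+* F}
    (hpl : (InfinitePlace.mk f'.p = InfinitePlace.mk (g.twist τ).p ∧ InfinitePlace.mk f'.p' = InfinitePlace.mk (g.twist τ).p') ∨
      (InfinitePlace.mk f'.p = InfinitePlace.mk (g.twist τ).p' ∧ InfinitePlace.mk f'.p' = InfinitePlace.mk (g.twist τ).p))
    (hΦ : f'.Φ = (g.twist τ).Φ ∨ f'.Φ = flip (g.twist τ).p (g.twist τ).Φ ∨ f'.Φ = flip (g.twist τ).p' (g.twist τ).Φ ∨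
      f'.Φ = flip (g.twist τ).p' (flip (g.twist τ).p (g.twist τ).Φ)) (σ : F →+* ℂ) :
    lefChar f'.corner (fun _ => ({σ} : Finset (F →+* ℂ))) ∈ AddSubgroup.closure
      {a : Asym F | ∃ σ' : F →+* ℂ, a = lefChar g.corner (fun _ => ({σ'} : Finset (F →+* ℂ)))} := by
  have hmem : lefChar (g.twist τ).corner (fun _ => ({σ} : Finset (F →+* ℂ))) ∈ AddSubgroup.closure
      {a : Asym F | ∃ σ' : F →+* ℂ, a = lefChar g.corner (fun _ => ({σ'} : Finset (F →+* ℂ)))} := by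
    rw [lefChar_corner_twist]
    exact AddSubgroup.subset_closure ⟨_, rfl⟩
  rcases lefChar_corner_of_sameSquare hpl hΦ σ with h | h
  · rw [h]; exact hmem
  · rw [h]; exact AddSubgroup.neg_mem _ hmem

/-- **Saturation generates nothing new.**  If every member of `𝒮′` shares its type square with a Galois twist of a member of `𝒮`,
the subgroup of `Asym F` generated by the Weil characters (at all base embeddings) of the faces of `𝒮′` is contained in the one
generated by those of `𝒮`. [cite: Milne1999LefschetzClasses, Thm. 3.2] -/
theorem closure_le_of_saturation (𝒮 𝒮' : Set (Face F))
    (hsat : ∀ g' ∈ 𝒮', ∃ g ∈ 𝒮, ∃ τ : F ≃+* F,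
      ((InfinitePlace.mk g'.p = InfinitePlace.mk (g.twist τ).p ∧ InfinitePlace.mk g'.p' = InfinitePlace.mk (g.twist τ).p') ∨
        (InfinitePlace.mk g'.p = InfinitePlace.mk (g.twist τ).p' ∧ InfinitePlace.mk g'.p' = InfinitePlace.mk (g.twist τ).p)) ∧
      (g'.Φ = (g.twist τ).Φ ∨ g'.Φ = flip (g.twist τ).p (g.twist τ).Φ ∨ g'.Φ = flip (g.twist τ).p' (g.twist τ).Φ ∨
        g'.Φ = flip (g.twist τ).p' (flip (g.twist τ).p (g.twist τ).Φ))) :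
    AddSubgroup.closure {a : Asym F | ∃ g' ∈ 𝒮', ∃ σ : F →+* ℂ, a = lefChar g'.corner (fun _ => ({σ} : Finset (F →+* ℂ)))} ≤
      AddSubgroup.closure {a : Asym F | ∃ g ∈ 𝒮, ∃ σ : F →+* ℂ, a = lefChar g.corner (fun _ => ({σ} : Finset (F →+* ℂ)))} := by
  rw [AddSubgroup.closure_le]
  rintro a ⟨g', hg', σ, rfl⟩
  obtain ⟨g, hg, τ, hpl, hΦ⟩ := hsat g' hg'
  refine AddSubgroup.closure_mono ?_ (lefChar_corner_mem_closure_of_sameSquare_twist hpl hΦ σ)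
  rintro b ⟨σ', rfl⟩
  exact ⟨g, hg, σ', rfl⟩

/-- **`hgen(𝒮′) ⟹ hgen(𝒮)` when `𝒮′` lies in the saturation of `𝒮`** (every member of `𝒮′` shares its type square with a Galois
twist of a member of `𝒮`).  So a generation certificate over the union of the orbits of `𝒮` (all twists, all eight faces of each
square) already gives the face reduction of `CorCM/FacePeriodsGeneratingSet.lean` with Weil lines / period witnesses on `𝒮` itself.
[cite: Milne1999LefschetzClasses, Thm. 3.2] [cite: Pohlmann1968, Thm. 1] -/
theorem hgen_of_hgen_saturation (𝒮 𝒮' : Set (Face F))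
    (hsat : ∀ g' ∈ 𝒮', ∃ g ∈ 𝒮, ∃ τ : F ≃+* F,
      ((InfinitePlace.mk g'.p = InfinitePlace.mk (g.twist τ).p ∧ InfinitePlace.mk g'.p' = InfinitePlace.mk (g.twist τ).p') ∨
        (InfinitePlace.mk g'.p = InfinitePlace.mk (g.twist τ).p' ∧ InfinitePlace.mk g'.p' = InfinitePlace.mk (g.twist τ).p)) ∧
      (g'.Φ = (g.twist τ).Φ ∨ g'.Φ = flip (g.twist τ).p (g.twist τ).Φ ∨ g'.Φ = flip (g.twist τ).p' (g.twist τ).Φ ∨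
        g'.Φ = flip (g.twist τ).p' (flip (g.twist τ).p (g.twist τ).Φ)))
    (σ₀ : F →+* ℂ)
    (hgen' : ∀ f : Face F, lefChar f.corner (fun _ => ({σ₀} : Finset (F →+* ℂ))) ∈ AddSubgroup.closure
      {a : Asym F | ∃ g' ∈ 𝒮', ∃ σ : F →+* ℂ, a = lefChar g'.corner (fun _ => ({σ} : Finset (F →+* ℂ)))})
    (f : Face F) :
    lefChar f.corner (fun _ => ({σ₀} : Finset (F →+* ℂ))) ∈ AddSubgroup.closure
      {a : Asym F | ∃ g ∈ 𝒮, ∃ σ : F →+* ℂ, a = lefChar g.corner (fun _ => ({σ} : Finset (F →+* ℂ)))} :=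
  closure_le_of_saturation 𝒮 𝒮' hsat (hgen' f)

/-! ## §3 The pre-quotient socket: corner-indicator identities in `ℤ[types]` -/

/-- **`hgen` FROM CORNER-INDICATOR IDENTITIES (pre-quotient socket).**  If for every face `f` of `F` the corner indicator of `f` read
at `σ₀` (`weightRel f.corner (fun _ => {σ₀})`, §1) lies, inside `ℤ[types of (E, c)]`, in the span of the corner indicators of the
faces of `𝒮` read at all base embeddings together with the pair relations `[Ψ] + [Ψ̄]` — the shape of the identities
`1_{corners f} = Σ_i c_i · 1_{corners g_i} + Σ_j d_j · 1_{{P_j, P̄_j}}` of a finite census certificate — then `hgen(𝒮, σ₀)` holds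
(`ā` is additive and kills `pairRel`; `abar_weightRel`). [cite: Pohlmann1968, Thm. 1] [cite: Milne1999LefschetzClasses, Thm. 3.2] -/
theorem hgen_of_weightRel_mem_span (𝒮 : Set (Face F)) (σ₀ : F →+* ℂ)
    (hcert : ∀ f : Face F, weightRel f.corner (fun _ => ({σ₀} : Finset (F →+* ℂ))) ∈
      Submodule.span ℤ {y : CMF (GalT F) conjT →₀ ℤ | ∃ g ∈ 𝒮, ∃ σ : F →+* ℂ,
          y = weightRel g.corner (fun _ => ({σ} : Finset (F →+* ℂ)))} ⊔ pairRel)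
    (f : Face F) :
    lefChar f.corner (fun _ => ({σ₀} : Finset (F →+* ℂ))) ∈ AddSubgroup.closure
      {a : Asym F | ∃ g ∈ 𝒮, ∃ σ : F →+* ℂ, a = lefChar g.corner (fun _ => ({σ} : Finset (F →+* ℂ)))} := by
  rw [← abar_weightRel]
  obtain ⟨y, hy, z, hz, hyz⟩ := Submodule.mem_sup.mp (hcert f)
  have hz0 : abar z = 0 := (Submodule.Quotient.mk_eq_zero _).mpr hz
  rw [← hyz, map_add, hz0, add_zero]
  refine Submodule.span_induction (p := fun y _ => abar y ∈ AddSubgroup.closure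
      {a : Asym F | ∃ g ∈ 𝒮, ∃ σ : F →+* ℂ, a = lefChar g.corner (fun _ => ({σ} : Finset (F →+* ℂ)))}) ?_ ?_ ?_ ?_ hy
  · rintro _ ⟨g, hg, σ, rfl⟩
    rw [abar_weightRel]
    exact AddSubgroup.subset_closure ⟨g, hg, σ, rfl⟩
  · rw [map_zero]
    exact AddSubgroup.zero_mem _
  · intro a b _ _ ha hb
    rw [map_add]
    exact AddSubgroup.add_mem _ ha hb
  · intro n a _ ha
    rw [map_zsmul]
    exact AddSubgroup.zsmul_mem _ ha n

/-- **The census socket, assembled:** corner-indicator identities over the SATURATION `𝒮′` of `𝒮` (every member of `𝒮′` shares its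
type square with a Galois twist of a member of `𝒮`) give `hgen(𝒮, σ₀)` — the binder of `Universe.hc_cmProd_of_faceSet` /
`hodgeConjectureFor_of_avDominatedBy_isProductOf_of_exists_facePeriod_on` for the SMALL set `𝒮`.
[cite: Pohlmann1968, Thm. 1] [cite: Milne1999LefschetzClasses, Thm. 3.2] -/
theorem hgen_of_weightRel_mem_span_saturation (𝒮 𝒮' : Set (Face F))
    (hsat : ∀ g' ∈ 𝒮', ∃ g ∈ 𝒮, ∃ τ : F ≃+* F,
      ((InfinitePlace.mk g'.p = InfinitePlace.mk (g.twist τ).p ∧ InfinitePlace.mk g'.p' = InfinitePlace.mk (g.twist τ).p') ∨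
        (InfinitePlace.mk g'.p = InfinitePlace.mk (g.twist τ).p' ∧ InfinitePlace.mk g'.p' = InfinitePlace.mk (g.twist τ).p)) ∧
      (g'.Φ = (g.twist τ).Φ ∨ g'.Φ = flip (g.twist τ).p (g.twist τ).Φ ∨ g'.Φ = flip (g.twist τ).p' (g.twist τ).Φ ∨
        g'.Φ = flip (g.twist τ).p' (flip (g.twist τ).p (g.twist τ).Φ)))
    (σ₀ : F →+* ℂ)
    (hcert : ∀ f : Face F, weightRel f.corner (fun _ => ({σ₀} : Finset (F →+* ℂ))) ∈
      Submodule.span ℤ {y : CMF (GalT F) conjT →₀ ℤ | ∃ g' ∈ 𝒮', ∃ σ : F →+* ℂ,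
          y = weightRel g'.corner (fun _ => ({σ} : Finset (F →+* ℂ)))} ⊔ pairRel)
    (f : Face F) :
    lefChar f.corner (fun _ => ({σ₀} : Finset (F →+* ℂ))) ∈ AddSubgroup.closure
      {a : Asym F | ∃ g ∈ 𝒮, ∃ σ : F →+* ℂ, a = lefChar g.corner (fun _ => ({σ} : Finset (F →+* ℂ)))} :=
  hgen_of_hgen_saturation 𝒮 𝒮' hsat σ₀ (hgen_of_weightRel_mem_span 𝒮' σ₀ hcert) f

end Summit.HodgeConjecture.CorCM

end
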